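import Literature.Analysis.Complex.EvenDoubleRootCriticalValue
import HarnessLib

/-!
# A symmetric double root: the off-axis critical value differs from the axis value

Local complex analysis in several variables (E. M. Chirka, *Complex Analytic Sets* (1989), §1.1, §2.8), sequel of
`EvenDoubleRootCriticalValue`.  Written by the prover seat `hodge-nonav-prover-Bx` (g12, cell `hodge-nonav`) for the
bifurcation analysis of the symmetric `A₃` point (programme B2-BIF): this is the step showing that the two branches
`β = 0` (axis node) and `β = ψ(α)` (pair of off-axis nodes) of the bifurcation set of `B₂` meet only at the origin
(AGZV II §5.2: `λ₂ = 0` versus `λ₁² = 4λ₂`).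

In the setting of `SCV.exists_evenCriticalValue` (`φ = φ(·,0) + u² q`, `q` even, `s = 2q + u ∂_u q`,
`G = φ(·, 0) + ½ e Q`):

* `SCV.exists_fderiv_u_eq_mul_of_even` — `∂_u q` is odd, hence `∂_u q = u · q₂` with `q₂` holomorphic;
* `SCV.sq_quotient_unique` — the quotient `q` in `φ = φ(·, 0) + u² q` is unique;
* `SCV.quadraticCoeff_ne_zero_of_order_two` — if `s(0, ·)` has order exactly `2` at `u = 0` and `q(0) = 0`, then
  `q₂(0) ≠ 0`;
* `SCV.criticalValue_ne_axisValue` — where `q₂ ≠ 0`: if `s(z, 0) ≠ 0` (the roots `±ρ(z)` are off the axis) then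
  `G(z) ≠ φ(z, 0)`; indeed `G(z) − φ(z, 0) = −½ ρ⁴ q₂(z, ρ)`.

## References
* [Chirka1989] E. M. Chirka, *Complex Analytic Sets*, Kluwer 1989, §1.1, §2.8.
* [ArnoldGuseinzadeVarchenko2012] AGZV II, Part I §5.2.
-/

noncomputable section

open Metric Set Filter
open scoped Topology

namespace Literature.Analysis.Complex
namespace SCV

variable {E : Type*} [NormedAddCommGroup E] [NormedSpace ℂ E]

/-- **The `u`-derivative of an even holomorphic function is `u` times a holomorphic function.**
[cite: Chirka1989, §2.8] -/
theorem exists_fderiv_u_eq_mul_of_even [FiniteDimensional ℂ E] {V : Set E} (hV : IsOpen V) {R : ℝ}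
    {q : E × ℂ → ℂ} (hq : DifferentiableOn ℂ q (V ×ˢ ball (0 : ℂ) R))
    (hqeven : ∀ p ∈ V ×ˢ ball (0 : ℂ) R, q (p.1, -p.2) = q p) :
    ∃ q₂ : E × ℂ → ℂ, DifferentiableOn ℂ q₂ (V ×ˢ ball (0 : ℂ) R) ∧
      ∀ p ∈ V ×ˢ ball (0 : ℂ) R, fderiv ℂ q p (0, 1) = p.2 * q₂ p := by
  have hU : IsOpen (V ×ˢ ball (0 : ℂ) R) := hV.prod isOpen_ball
  have hrefl : ∀ p ∈ V ×ˢ ball (0 : ℂ) R, (p.1, -p.2) ∈ V ×ˢ ball (0 : ℂ) R := fun p hp =>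
    ⟨hp.1, by simpa using hp.2⟩
  -- `∂_u q` is holomorphic
  have hqA : AnalyticOnNhd ℂ q (V ×ˢ ball (0 : ℂ) R) := analyticOnNhd_of_differentiableOn hq hU
  have hdq : DifferentiableOn ℂ (fun p => fderiv ℂ q p (0, 1)) (V ×ˢ ball (0 : ℂ) R) :=
    ((hqA.fderiv_of_isOpen hU).differentiableOn).clm_apply (differentiableOn_const _)
  -- and odd: differentiate `q(z, -u) = q(z, u)` in `u`
  have hodd0 : ∀ p ∈ V ×ˢ ball (0 : ℂ) R, (fun p : E × ℂ => p.2) p = 0 → fderiv ℂ q p (0, 1) = 0 := by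
    intro p hp hp0
    change p.2 = 0 at hp0
    have hρd : HasFDerivAt (fun p : E × ℂ => ((p.1, -p.2) : E × ℂ))
        ((ContinuousLinearMap.fst ℂ E ℂ).prod (-ContinuousLinearMap.snd ℂ E ℂ)) p :=
      (ContinuousLinearMap.fst ℂ E ℂ).hasFDerivAt.prodMk (ContinuousLinearMap.snd ℂ E ℂ).hasFDerivAt.neg
    have hpfix : ((p.1, -p.2) : E × ℂ) = p := Prod.ext rfl (by rw [hp0, neg_zero])
    have hq1 : HasFDerivAt q (fderiv ℂ q p) p := (hq.differentiableAt (hU.mem_nhds hp)).hasFDerivAt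
    have hq1' : HasFDerivAt q (fderiv ℂ q p) ((p.1, -p.2) : E × ℂ) := by rw [hpfix]; exact hq1
    have hcomp : HasFDerivAt (fun p : E × ℂ => q (p.1, -p.2))
        ((fderiv ℂ q p).comp ((ContinuousLinearMap.fst ℂ E ℂ).prod (-ContinuousLinearMap.snd ℂ E ℂ))) p := by
      have h := hq1'.comp p hρd
      exact h
    have heq : (fun p : E × ℂ => q (p.1, -p.2)) =ᶠ[𝓝 p] q := by
      filter_upwards [hU.mem_nhds hp] with p' hp'
      exact hqeven p' hp'
    have huniq := hq1.unique (hcomp.congr_of_eventuallyEq heq.symm)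
    have happ := congr_arg (fun L : E × ℂ →L[ℂ] ℂ => L (0, 1)) huniq
    simp only [ContinuousLinearMap.comp_apply, ContinuousLinearMap.prod_apply, ContinuousLinearMap.coe_fst',
      neg_apply, ContinuousLinearMap.coe_snd'] at happ
    -- happ : fderiv q p (0, 1) = fderiv q p (0, -1)
    have hneg : ((0 : E), (-1 : ℂ)) = -((0 : E), (1 : ℂ)) := by simp
    rw [hneg, map_neg] at happ
    have h2 : (2 : ℂ) * fderiv ℂ q p (0, 1) = 0 := by linear_combination happ
    exact (mul_eq_zero.1 h2).resolve_left two_ne_zero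
  -- divide by `u`
  have htd : DifferentiableOn ℂ (fun p : E × ℂ => p.2) (V ×ˢ ball (0 : ℂ) R) := differentiableOn_snd
  have hdt : ∀ p ∈ V ×ˢ ball (0 : ℂ) R, (fun p : E × ℂ => p.2) p = 0 → fderiv ℂ (fun p : E × ℂ => p.2) p ≠ 0 := by
    intro p _ _ hzero
    have h1 : fderiv ℂ (fun p : E × ℂ => p.2) p = ContinuousLinearMap.snd ℂ E ℂ :=
      (ContinuousLinearMap.snd ℂ E ℂ).hasFDerivAt.fderiv
    have := congr_arg (fun L : E × ℂ →L[ℂ] ℂ => L (0, 1)) (h1.symm.trans hzero)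
    simp at this
  obtain ⟨q₂, hq₂d, hq₂⟩ := exists_eq_smul_of_eqOn_zero hU htd hdq hdt hodd0
  exact ⟨q₂, hq₂d, fun p hp => by rw [hq₂ p hp, smul_eq_mul]⟩

omit [NormedSpace ℂ E] in
/-- **Uniqueness of the quadratic quotient**: if `φ(z, u) − φ(z, 0) = u² q(z, u) = u² q'(z, u)` on `V × {|u| < R}`
with `q, q'` continuous, then `q = q'` (cancel `u²` off the axis, continuity on it). [cite: Chirka1989, §2.8] -/
theorem sq_quotient_unique {V : Set E} (hV : IsOpen V) {R : ℝ} {f q q' : E × ℂ → ℂ}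
    (hq : ContinuousOn q (V ×ˢ ball (0 : ℂ) R)) (hq' : ContinuousOn q' (V ×ˢ ball (0 : ℂ) R))
    (h : ∀ p ∈ V ×ˢ ball (0 : ℂ) R, f p = p.2 ^ 2 * q p) (h' : ∀ p ∈ V ×ˢ ball (0 : ℂ) R, f p = p.2 ^ 2 * q' p) :
    ∀ p ∈ V ×ˢ ball (0 : ℂ) R, q p = q' p := by
  have hU : IsOpen (V ×ˢ ball (0 : ℂ) R) := hV.prod isOpen_ball
  have hoff : ∀ p ∈ V ×ˢ ball (0 : ℂ) R, p.2 ≠ 0 → q p = q' p := by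
    intro p hp hne
    have := (h p hp).symm.trans (h' p hp)
    exact mul_left_cancel₀ (pow_ne_zero 2 hne) this
  intro p hp
  by_cases hne : p.2 ≠ 0
  · exact hoff p hp hne
  push Not at hne
  have hz : p = (p.1, 0) := Prod.ext rfl hne
  have hball : ∀ᶠ u in 𝓝 (0 : ℂ), ((p.1, u) : E × ℂ) ∈ V ×ˢ ball (0 : ℂ) R := by
    have e1 : Continuous (fun u : ℂ => ((p.1, u) : E × ℂ)) := by fun_prop
    exact e1.continuousAt.preimage_mem_nhds (hU.mem_nhds (by exact hz ▸ hp))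
  have hp' : ((p.1, (0 : ℂ)) : E × ℂ) ∈ V ×ˢ ball (0 : ℂ) R := hz ▸ hp
  have e1 : ContinuousAt (fun u : ℂ => ((p.1, u) : E × ℂ)) 0 := by fun_prop
  have hcont : ContinuousAt (fun u : ℂ => q (p.1, u) - q' (p.1, u)) 0 :=
    ((hq.continuousAt (hU.mem_nhds hp')).comp_of_eq e1 rfl).sub
      ((hq'.continuousAt (hU.mem_nhds hp')).comp_of_eq e1 rfl)
  have hev : ∀ᶠ u in 𝓝[≠] (0 : ℂ), q (p.1, u) - q' (p.1, u) = 0 := by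
    have h1 : ∀ᶠ u in 𝓝[≠] (0 : ℂ), u ≠ 0 := self_mem_nhdsWithin
    filter_upwards [h1, mem_nhdsWithin_of_mem_nhds hball] with u hu hmem
    rw [hoff (p.1, u) hmem hu, sub_self]
  have h1 : Tendsto (fun u : ℂ => q (p.1, u) - q' (p.1, u)) (𝓝[≠] (0 : ℂ)) (𝓝 (q (p.1, 0) - q' (p.1, 0))) :=
    hcont.tendsto.mono_left nhdsWithin_le_nhds
  have h2 : Tendsto (fun u : ℂ => q (p.1, u) - q' (p.1, u)) (𝓝[≠] (0 : ℂ)) (𝓝 0) :=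
    (tendsto_congr' hev).2 tendsto_const_nhds
  have := tendsto_nhds_unique h1 h2
  rw [hz]
  exact sub_eq_zero.1 this

/-- **The quadratic coefficient is nonzero when the order is two.**  On `V × {|u| < R}` (`0 ∈ V`) let
`s = 2 q + u ∂_u q` with `q` holomorphic, `q(0) = 0`, and `∂_u q = u · q₂` (`q₂` holomorphic).  If `s(0, ·)` has a
zero of order exactly `2` at `u = 0` then `q₂(0) ≠ 0` (otherwise `s(0, u) = O(u³)`). [cite: Chirka1989, §1.1] -/
theorem quadraticCoeff_ne_zero_of_order_two {V : Set E} (hV : IsOpen V) (h0V : (0 : E) ∈ V) {R : ℝ} (hR : 0 < R)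
    {s q q₂ : E × ℂ → ℂ} (hq : DifferentiableOn ℂ q (V ×ˢ ball (0 : ℂ) R))
    (hq₂ : DifferentiableOn ℂ q₂ (V ×ˢ ball (0 : ℂ) R)) (hq0 : q 0 = 0)
    (hs : ∀ p ∈ V ×ˢ ball (0 : ℂ) R, s p = 2 * q p + p.2 * fderiv ℂ q p (0, 1))
    (hdq : ∀ p ∈ V ×ˢ ball (0 : ℂ) R, fderiv ℂ q p (0, 1) = p.2 * q₂ p)
    (hord : analyticOrderAt (fun u : ℂ => s ((0 : E), u)) 0 = 2) : q₂ 0 ≠ 0 := by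
  intro hq₂0
  have hU : IsOpen (V ×ˢ ball (0 : ℂ) R) := hV.prod isOpen_ball
  have h00 : ((0 : E), (0 : ℂ)) ∈ V ×ˢ ball (0 : ℂ) R := ⟨h0V, mem_ball_self hR⟩
  -- the line `u ↦ (0, u)`
  have hℓc : Continuous (fun u : ℂ => (((0 : E), u) : E × ℂ)) := by fun_prop
  have hℓa : ∀ u : ℂ, AnalyticAt ℂ (fun u : ℂ => (((0 : E), u) : E × ℂ)) u := fun u =>
    analyticAt_const.prod analyticAt_id
  have hpre : IsOpen ((fun u : ℂ => (((0 : E), u) : E × ℂ)) ⁻¹' (V ×ˢ ball (0 : ℂ) R)) := hU.preimage hℓc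
  have h0pre : (0 : ℂ) ∈ (fun u : ℂ => (((0 : E), u) : E × ℂ)) ⁻¹' (V ×ˢ ball (0 : ℂ) R) := h00
  have hball : ∀ᶠ u in 𝓝 (0 : ℂ), (((0 : E), u) : E × ℂ) ∈ V ×ˢ ball (0 : ℂ) R := hpre.mem_nhds h0pre
  -- restrictions to the line are analytic
  have hlineA : ∀ {g : E × ℂ → ℂ}, DifferentiableOn ℂ g (V ×ˢ ball (0 : ℂ) R) →
      AnalyticAt ℂ (fun u : ℂ => g ((0 : E), u)) 0 := by
    intro g hg
    have hdiff : DifferentiableOn ℂ (fun u : ℂ => g ((0 : E), u))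
        ((fun u : ℂ => (((0 : E), u) : E × ℂ)) ⁻¹' (V ×ˢ ball (0 : ℂ) R)) :=
      hg.comp (fun u _ => (hℓa u).differentiableAt.differentiableWithinAt) fun u hu => hu
    exact hdiff.analyticAt (hpre.mem_nhds h0pre)
  have hκa : AnalyticAt ℂ (fun u : ℂ => q ((0 : E), u)) 0 := hlineA hq
  have hq₂a : AnalyticAt ℂ (fun u : ℂ => q₂ ((0 : E), u)) 0 := hlineA hq₂
  -- `κ' = ∂_u q (0, ·)` near `0`
  have hκd : ∀ᶠ u in 𝓝 (0 : ℂ), HasDerivAt (fun u : ℂ => q ((0 : E), u)) (fderiv ℂ q ((0 : E), u) (0, 1)) u := by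
    refine hball.mono fun u hu => ?_
    have hℓd : HasDerivAt (fun u : ℂ => (((0 : E), u) : E × ℂ)) (((0 : E), (1 : ℂ)) : E × ℂ) u :=
      (hasDerivAt_const u (0 : E)).prodMk (hasDerivAt_id' u)
    have h := (hq.differentiableAt (hU.mem_nhds hu)).hasFDerivAt.comp_hasDerivAt u hℓd
    exact h
  have hκ' : deriv (fun u : ℂ => q ((0 : E), u)) =ᶠ[𝓝 (0 : ℂ)] fun u => u * q₂ ((0 : E), u) := by
    filter_upwards [hκd, hball] with u hu hmem
    rw [hu.deriv, hdq _ hmem]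
  -- orders: `ord κ' ≥ 3 - 1`, hence `ord κ ≥ 3`; and `ord (u κ') ≥ 3`; so `ord s(0, ·) ≥ 3`
  have hq₂fac : (1 : ℕ) ≤ analyticOrderAt (fun u : ℂ => q₂ ((0 : E), u)) 0 := by
    rw [ENat.coe_one, Order.one_le_iff_ne_zero, hq₂a.analyticOrderAt_ne_zero]
    exact hq₂0
  obtain ⟨g, hga, hg⟩ := (natCast_le_analyticOrderAt hq₂a).1 hq₂fac
  -- `q₂(0, u) = u • g u` near `0`
  have hκ'3 : ((2 : ℕ) : ℕ∞) ≤ analyticOrderAt (deriv fun u : ℂ => q ((0 : E), u)) 0 := by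
    rw [analyticOrderAt_congr hκ']
    refine (natCast_le_analyticOrderAt ?_).2 ⟨g, hga, ?_⟩
    · exact analyticAt_id.fun_mul hq₂a
    · filter_upwards [hg] with u hu
      rw [hu, sub_zero, smul_eq_mul, smul_eq_mul]; ring
  have hκ3 : ((3 : ℕ) : ℕ∞) ≤ analyticOrderAt (fun u : ℂ => q ((0 : E), u)) 0 := by
    have h := hκa.analyticOrderAt_deriv_add_one
    have hfun : (fun u : ℂ => q ((0 : E), u) - q ((0 : E), (0 : ℂ))) = fun u => q ((0 : E), u) := by
      funext u
      have : q ((0 : E), (0 : ℂ)) = 0 := hq0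
      rw [this, sub_zero]
    rw [hfun] at h
    rw [← h]
    have : ((3 : ℕ) : ℕ∞) = ((2 : ℕ) : ℕ∞) + 1 := by norm_num
    rw [this]
    exact add_le_add hκ'3 le_rfl
  have hterm1 : ((3 : ℕ) : ℕ∞) ≤ analyticOrderAt (fun u : ℂ => 2 * q ((0 : E), u)) 0 := by
    obtain ⟨g₁, hg₁a, hg₁⟩ := (natCast_le_analyticOrderAt hκa).1 hκ3
    refine (natCast_le_analyticOrderAt (analyticAt_const.fun_mul hκa)).2 ⟨fun u => 2 * g₁ u, by fun_prop, ?_⟩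
    filter_upwards [hg₁] with u hu
    rw [hu, smul_eq_mul, smul_eq_mul]; ring
  have hterm2 : ((3 : ℕ) : ℕ∞) ≤ analyticOrderAt (fun u : ℂ => u * fderiv ℂ q ((0 : E), u) (0, 1)) 0 := by
    have ha : AnalyticAt ℂ (fun u : ℂ => u * fderiv ℂ q ((0 : E), u) (0, 1)) 0 := by
      refine (analyticAt_id.fun_mul (analyticAt_id.fun_mul hq₂a)).congr ?_
      filter_upwards [hball] with u hu
      change u * (u * q₂ ((0 : E), u)) = u * fderiv ℂ q ((0 : E), u) (0, 1)
      rw [hdq _ hu]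
    refine (natCast_le_analyticOrderAt ha).2 ⟨g, hga, ?_⟩
    filter_upwards [hball, hg] with u hu hgu
    rw [hdq _ hu]
    change u * (u * q₂ ((0 : E), u)) = (u - 0) ^ 3 • g u
    rw [hgu, sub_zero, smul_eq_mul, smul_eq_mul]; ring
  have hsum : ((3 : ℕ) : ℕ∞) ≤ analyticOrderAt (fun u : ℂ => s ((0 : E), u)) 0 := by
    have heq : (fun u : ℂ => s ((0 : E), u)) =ᶠ[𝓝 (0 : ℂ)]
        ((fun u : ℂ => 2 * q ((0 : E), u)) + fun u : ℂ => u * fderiv ℂ q ((0 : E), u) (0, 1)) := by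
      filter_upwards [hball] with u hu
      rw [Pi.add_apply, hs _ hu]
    rw [analyticOrderAt_congr heq]
    exact (le_min hterm1 hterm2).trans le_analyticOrderAt_add
  rw [hord] at hsum
  exact absurd hsum (by norm_num)

/-- **The off-axis critical value differs from the axis value.**  In the setting of
`SCV.exists_evenCriticalValue` (`G(z) = φ(z, 0) + ½ e(z) Q(z)`, a root `ρ` of `s(z, ·)` with `e(z) = 2ρ²`,
`Q(z) = q(z, ρ)`, `s = 2q + u ∂_u q`) suppose `∂_u q = u · q₂` with `q₂(z, ρ) ≠ 0`.  If `s(z, 0) ≠ 0` then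
`G(z) ≠ φ(z, 0)`: indeed `G(z) − φ(z, 0) = −½ ρ⁴ q₂(z, ρ)` and `ρ ≠ 0`. [cite: ArnoldGuseinzadeVarchenko2012, Part I §5.2] -/
theorem criticalValue_ne_axisValue {s q q₂ : E × ℂ → ℂ} {Gz φz0 ez Qz : ℂ} {z : E} {ρ : ℂ}
    (hG : Gz = φz0 + (1 / 2 : ℂ) * ez * Qz) (he : ez = 2 * ρ ^ 2) (hQ : Qz = q (z, ρ))
    (hsρ : s (z, ρ) = 0) (hs : s (z, ρ) = 2 * q (z, ρ) + ρ * fderiv ℂ q (z, ρ) (0, 1))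
    (hdq : fderiv ℂ q (z, ρ) (0, 1) = ρ * q₂ (z, ρ)) (hq₂ : q₂ (z, ρ) ≠ 0) (hs0 : s (z, 0) ≠ 0) :
    Gz ≠ φz0 ∧ Gz - φz0 = -(1 / 2 : ℂ) * ρ ^ 4 * q₂ (z, ρ) := by
  have hρ : ρ ≠ 0 := by
    rintro rfl
    exact hs0 hsρ
  have hval : Gz - φz0 = -(1 / 2 : ℂ) * ρ ^ 4 * q₂ (z, ρ) := by
    rw [hsρ, hdq] at hs
    rw [hG, he, hQ]
    linear_combination (-(1 / 2 : ℂ) * ρ ^ 2) * hs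
  refine ⟨fun h => ?_, hval⟩
  rw [h, sub_self] at hval
  have : -(1 / 2 : ℂ) * ρ ^ 4 * q₂ (z, ρ) ≠ 0 :=
    mul_ne_zero (mul_ne_zero (by norm_num) (pow_ne_zero 4 hρ)) hq₂
  exact this hval.symm

end SCV
end Literature.Analysis.Complex

end
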